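import Mathlib
import Summits.AtomisticToContinuum.HydrodynamicLimit.Theorems.OneSphereInfluenceStaticScoreResponseGaussMoments
import Literature.MathematicalPhysics.KineticTheory.HardSphereEulerProofs
import HarnessLib

/-!
# `StaticScoreResponse` (support item stmt-AtomisticToContinuum-12269): integration against the
# product of standard Gaussians on `(ℝ³)ⁿ`

Bookkeeping for the velocity integrals of the local Gibbs measure in Gaussian coordinates:

* "quadratic observables" `Q(w) = α + ⟪w, β⟫ + c ‖w‖²` of one velocity (the velocity score and the
  one-particle density / momentum / energy observables are all of this form): the bound
  `|Q| ≤ (|α| + ‖β‖ + |c|)(1 + ‖w‖²)`, integrability and the Gaussian table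
  `E Q = α + 3c`, `E Q⟪w,β'⟫ = ⟪β,β'⟫`, `E Q‖w‖² = 3α + 15c`, `E Q Q'` (`integral_quad_mul_quad`);
* under `γ^{⊗n} = Measure.pi (fun _ : Fin n => stdGaussian ℝ³)`: one-velocity marginals
  (`integral_comp_eval_gaussPi`), independence of two distinct velocities
  (`integral_comp_eval_mul_comp_eval_gaussPi`), integrability from a bound
  `C (1 + ‖wᵢ‖²)(1 + ‖wⱼ‖²)` (`integrable_gaussPi_of_le`, also on a product with a finite measure),
  and the second-moment bookkeeping identity `integral_sum_mul_sum_gaussPi`.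

Folklore; no definitions, no named facts.
-/

noncomputable section

namespace Summit.AtomisticToContinuum.HydrodynamicLimit.Theorems

open MeasureTheory ProbabilityTheory Set Filter Topology Finset
  Literature.MathematicalPhysics.KineticTheory
open scoped ENNReal NNReal InnerProductSpace

/-! ### Quadratic observables of one velocity under `γ` on `ℝ³` -/

/-- **The quadratic-observable bound** `|α + ⟪w, β⟫ + c‖w‖²| ≤ (|α| + ‖β‖ + |c|)(1 + ‖w‖²)`. [folklore] -/
theorem abs_quad_le (α c : ℝ) (β w : V3) :
    |α + ⟪w, β⟫_ℝ + c * ‖w‖ ^ 2| ≤ (|α| + ‖β‖ + |c|) * (1 + ‖w‖ ^ 2) := by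
  have h0 : (0 : ℝ) ≤ ‖w‖ ^ 2 := by positivity
  have h1 : |⟪w, β⟫_ℝ| ≤ ‖β‖ * (1 + ‖w‖ ^ 2) :=
    calc |⟪w, β⟫_ℝ| ≤ ‖w‖ * ‖β‖ := abs_real_inner_le_norm _ _
      _ ≤ (1 + ‖w‖ ^ 2) * ‖β‖ :=
          mul_le_mul_of_nonneg_right (by nlinarith [norm_nonneg w, sq_nonneg (‖w‖ - 1)]) (norm_nonneg _)
      _ = ‖β‖ * (1 + ‖w‖ ^ 2) := mul_comm _ _
  have h2 : |α| ≤ |α| * (1 + ‖w‖ ^ 2) := le_mul_of_one_le_right (abs_nonneg _) (by linarith)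
  have h3 : |c * ‖w‖ ^ 2| ≤ |c| * (1 + ‖w‖ ^ 2) := by
    rw [abs_mul, abs_of_nonneg h0]
    exact mul_le_mul_of_nonneg_left (by linarith) (abs_nonneg c)
  calc |α + ⟪w, β⟫_ℝ + c * ‖w‖ ^ 2| ≤ |α| + |⟪w, β⟫_ℝ| + |c * ‖w‖ ^ 2| := abs_add_three _ _ _
    _ ≤ |α| * (1 + ‖w‖ ^ 2) + ‖β‖ * (1 + ‖w‖ ^ 2) + |c| * (1 + ‖w‖ ^ 2) := by linarith
    _ = (|α| + ‖β‖ + |c|) * (1 + ‖w‖ ^ 2) := by ring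

/-- **Polynomially bounded functions are `γ`-integrable**: `|F| ≤ C (1 + ‖w‖⁴)` (Fernique).
[folklore] -/
theorem integrable_of_le_poly_gaussian {F : V3 → ℝ} (hF : AEStronglyMeasurable F (stdGaussian V3)) {C : ℝ}
    (hFC : ∀ w, |F w| ≤ C * (1 + ‖w‖ ^ 4)) : Integrable F (stdGaussian V3) := by
  refine Integrable.mono' (((integrable_const 1).add integrable_norm_pow_four_stdGaussian).const_mul C) hF
    (ae_of_all _ fun w => ?_)
  rw [Real.norm_eq_abs]
  exact hFC w

/-- `⟪w, β⟫` is `γ`-integrable. [folklore] -/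
theorem integrable_inner_gaussian (β : V3) : Integrable (fun w : V3 => ⟪w, β⟫_ℝ) (stdGaussian V3) := by
  refine integrable_of_le_poly_gaussian (by fun_prop : Measurable fun w : V3 => ⟪w, β⟫_ℝ).aestronglyMeasurable
    (C := ‖β‖) fun w => ?_
  have hp : ∀ k : ℕ, k ≤ 4 → ‖w‖ ^ k ≤ 1 + ‖w‖ ^ 4 := fun k hk => by
    rcases le_or_gt ‖w‖ 1 with h1 | h1
    · exact (pow_le_one₀ (norm_nonneg _) h1).trans (le_add_of_nonneg_right (by positivity))
    · exact (pow_le_pow_right₀ h1.le hk).trans (le_add_of_nonneg_left zero_le_one)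
  calc |⟪w, β⟫_ℝ| ≤ ‖w‖ * ‖β‖ := abs_real_inner_le_norm _ _
    _ = ‖β‖ * ‖w‖ ^ 1 := by ring
    _ ≤ ‖β‖ * (1 + ‖w‖ ^ 4) := mul_le_mul_of_nonneg_left (hp _ (by norm_num)) (norm_nonneg _)

/-- `⟪w, β⟫⟪w, β'⟫` is `γ`-integrable. [folklore] -/
theorem integrable_inner_mul_inner_gaussian (β β' : V3) :
    Integrable (fun w : V3 => ⟪w, β⟫_ℝ * ⟪w, β'⟫_ℝ) (stdGaussian V3) := by
  refine integrable_of_le_poly_gaussian (by fun_prop : Measurable fun w : V3 => ⟪w, β⟫_ℝ * ⟪w, β'⟫_ℝ).aestronglyMeasurable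
    (C := ‖β‖ * ‖β'‖) fun w => ?_
  have hp : ∀ k : ℕ, k ≤ 4 → ‖w‖ ^ k ≤ 1 + ‖w‖ ^ 4 := fun k hk => by
    rcases le_or_gt ‖w‖ 1 with h1 | h1
    · exact (pow_le_one₀ (norm_nonneg _) h1).trans (le_add_of_nonneg_right (by positivity))
    · exact (pow_le_pow_right₀ h1.le hk).trans (le_add_of_nonneg_left zero_le_one)
  rw [abs_mul]
  calc |⟪w, β⟫_ℝ| * |⟪w, β'⟫_ℝ| ≤ (‖w‖ * ‖β‖) * (‖w‖ * ‖β'‖) :=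
        mul_le_mul (abs_real_inner_le_norm _ _) (abs_real_inner_le_norm _ _) (abs_nonneg _) (by positivity)
    _ = ‖β‖ * ‖β'‖ * ‖w‖ ^ 2 := by ring
    _ ≤ ‖β‖ * ‖β'‖ * (1 + ‖w‖ ^ 4) :=
        mul_le_mul_of_nonneg_left (hp _ (by norm_num)) (by positivity)

/-- `‖w‖²⟪w, β⟫` is `γ`-integrable. [folklore] -/
theorem integrable_norm_sq_mul_inner_gaussian (β : V3) :
    Integrable (fun w : V3 => ‖w‖ ^ 2 * ⟪w, β⟫_ℝ) (stdGaussian V3) := by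
  refine integrable_of_le_poly_gaussian (by fun_prop : Measurable fun w : V3 => ‖w‖ ^ 2 * ⟪w, β⟫_ℝ).aestronglyMeasurable
    (C := ‖β‖) fun w => ?_
  have hp : ∀ k : ℕ, k ≤ 4 → ‖w‖ ^ k ≤ 1 + ‖w‖ ^ 4 := fun k hk => by
    rcases le_or_gt ‖w‖ 1 with h1 | h1
    · exact (pow_le_one₀ (norm_nonneg _) h1).trans (le_add_of_nonneg_right (by positivity))
    · exact (pow_le_pow_right₀ h1.le hk).trans (le_add_of_nonneg_left zero_le_one)
  rw [abs_mul, abs_of_nonneg (by positivity)]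
  calc ‖w‖ ^ 2 * |⟪w, β⟫_ℝ| ≤ ‖w‖ ^ 2 * (‖w‖ * ‖β‖) :=
        mul_le_mul_of_nonneg_left (abs_real_inner_le_norm _ _) (by positivity)
    _ = ‖β‖ * ‖w‖ ^ 3 := by ring
    _ ≤ ‖β‖ * (1 + ‖w‖ ^ 4) := mul_le_mul_of_nonneg_left (hp _ (by norm_num)) (norm_nonneg _)

/-- `‖w‖²` is `γ`-integrable (re-export for `ℝ³`). [folklore] -/
theorem integrable_norm_sq_gaussian : Integrable (fun w : V3 => ‖w‖ ^ 2) (stdGaussian V3) :=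
  integrable_norm_sq_stdGaussian

/-- A quadratic observable is `γ`-integrable. [folklore] -/
theorem integrable_quad (α c : ℝ) (β : V3) :
    Integrable (fun w : V3 => α + ⟪w, β⟫_ℝ + c * ‖w‖ ^ 2) (stdGaussian V3) :=
  ((integrable_const α).add (integrable_inner_gaussian β)).add (integrable_norm_sq_gaussian.const_mul c)

/-- A quadratic observable times `⟪w, β'⟫` is `γ`-integrable. [folklore] -/
theorem integrable_quad_mul_inner (α c : ℝ) (β β' : V3) :
    Integrable (fun w : V3 => (α + ⟪w, β⟫_ℝ + c * ‖w‖ ^ 2) * ⟪w, β'⟫_ℝ) (stdGaussian V3) := by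
  have h : (fun w : V3 => (α + ⟪w, β⟫_ℝ + c * ‖w‖ ^ 2) * ⟪w, β'⟫_ℝ) =
      fun w => α * ⟪w, β'⟫_ℝ + ⟪w, β⟫_ℝ * ⟪w, β'⟫_ℝ + c * (‖w‖ ^ 2 * ⟪w, β'⟫_ℝ) := funext fun w => by ring
  rw [h]
  exact (((integrable_inner_gaussian β').const_mul α).add (integrable_inner_mul_inner_gaussian β β')).add
    ((integrable_norm_sq_mul_inner_gaussian β').const_mul c)

/-- A quadratic observable times `‖w‖²` is `γ`-integrable. [folklore] -/
theorem integrable_quad_mul_norm_sq (α c : ℝ) (β : V3) :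
    Integrable (fun w : V3 => (α + ⟪w, β⟫_ℝ + c * ‖w‖ ^ 2) * ‖w‖ ^ 2) (stdGaussian V3) := by
  have h : (fun w : V3 => (α + ⟪w, β⟫_ℝ + c * ‖w‖ ^ 2) * ‖w‖ ^ 2) =
      fun w => α * ‖w‖ ^ 2 + ‖w‖ ^ 2 * ⟪w, β⟫_ℝ + c * ‖w‖ ^ 4 := funext fun w => by ring
  rw [h]
  exact ((integrable_norm_sq_gaussian.const_mul α).add (integrable_norm_sq_mul_inner_gaussian β)).add
    (integrable_norm_pow_four_stdGaussian.const_mul c)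

/-- A product of two quadratic observables is `γ`-integrable. [folklore] -/
theorem integrable_quad_mul_quad (α c α' c' : ℝ) (β β' : V3) :
    Integrable (fun w : V3 => (α + ⟪w, β⟫_ℝ + c * ‖w‖ ^ 2) * (α' + ⟪w, β'⟫_ℝ + c' * ‖w‖ ^ 2)) (stdGaussian V3) := by
  have h : (fun w : V3 => (α + ⟪w, β⟫_ℝ + c * ‖w‖ ^ 2) * (α' + ⟪w, β'⟫_ℝ + c' * ‖w‖ ^ 2)) =
      fun w => α' * (α + ⟪w, β⟫_ℝ + c * ‖w‖ ^ 2) + (α + ⟪w, β⟫_ℝ + c * ‖w‖ ^ 2) * ⟪w, β'⟫_ℝ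
        + c' * ((α + ⟪w, β⟫_ℝ + c * ‖w‖ ^ 2) * ‖w‖ ^ 2) := funext fun w => by ring
  rw [h]
  exact (((integrable_quad α c β).const_mul α').add (integrable_quad_mul_inner α c β β')).add
    ((integrable_quad_mul_norm_sq α c β).const_mul c')

/-- **`E Q = α + 3c`**. [folklore] -/
theorem integral_quad (α c : ℝ) (β : V3) :
    ∫ w, (α + ⟪w, β⟫_ℝ + c * ‖w‖ ^ 2) ∂stdGaussian V3 = α + 3 * c := by
  have i1 : Integrable (fun w : V3 => α + ⟪w, β⟫_ℝ) (stdGaussian V3) := (integrable_const α).add (integrable_inner_gaussian β)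
  have i2 : Integrable (fun w : V3 => c * ‖w‖ ^ 2) (stdGaussian V3) := integrable_norm_sq_gaussian.const_mul c
  rw [integral_add i1 i2, integral_add (integrable_const α) (integrable_inner_gaussian β), integral_const_mul,
    integral_inner_stdGaussian, integral_norm_sq_stdGaussian, integral_const]
  simp
  ring

/-- **`E Q⟪w, β'⟫ = ⟪β, β'⟫`**. [folklore] -/
theorem integral_quad_mul_inner (α c : ℝ) (β β' : V3) :
    ∫ w, (α + ⟪w, β⟫_ℝ + c * ‖w‖ ^ 2) * ⟪w, β'⟫_ℝ ∂stdGaussian V3 = ⟪β, β'⟫_ℝ := by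
  classical
  have h : (fun w : V3 => (α + ⟪w, β⟫_ℝ + c * ‖w‖ ^ 2) * ⟪w, β'⟫_ℝ) =
      fun w => α * ⟪w, β'⟫_ℝ + ⟪w, β⟫_ℝ * ⟪w, β'⟫_ℝ + c * (‖w‖ ^ 2 * ⟪w, β'⟫_ℝ) := funext fun w => by ring
  have i1 : Integrable (fun w : V3 => α * ⟪w, β'⟫_ℝ) (stdGaussian V3) := (integrable_inner_gaussian β').const_mul α
  have i12 : Integrable (fun w : V3 => α * ⟪w, β'⟫_ℝ + ⟪w, β⟫_ℝ * ⟪w, β'⟫_ℝ) (stdGaussian V3) :=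
    i1.add (integrable_inner_mul_inner_gaussian β β')
  have i3 : Integrable (fun w : V3 => c * (‖w‖ ^ 2 * ⟪w, β'⟫_ℝ)) (stdGaussian V3) :=
    (integrable_norm_sq_mul_inner_gaussian β').const_mul c
  rw [h, integral_add i12 i3, integral_add i1 (integrable_inner_mul_inner_gaussian β β'),
    integral_const_mul, integral_const_mul, integral_inner_stdGaussian, integral_inner_mul_inner_stdGaussian,
    integral_norm_sq_mul_inner_stdGaussian]
  ring

/-- **`E Q‖w‖² = 3α + 15c`**. [folklore] -/
theorem integral_quad_mul_norm_sq (α c : ℝ) (β : V3) :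
    ∫ w, (α + ⟪w, β⟫_ℝ + c * ‖w‖ ^ 2) * ‖w‖ ^ 2 ∂stdGaussian V3 = 3 * α + 15 * c := by
  have h : (fun w : V3 => (α + ⟪w, β⟫_ℝ + c * ‖w‖ ^ 2) * ‖w‖ ^ 2) =
      fun w => α * ‖w‖ ^ 2 + ‖w‖ ^ 2 * ⟪w, β⟫_ℝ + c * ‖w‖ ^ 4 := funext fun w => by ring
  have i1 : Integrable (fun w : V3 => α * ‖w‖ ^ 2) (stdGaussian V3) := integrable_norm_sq_gaussian.const_mul α
  have i12 : Integrable (fun w : V3 => α * ‖w‖ ^ 2 + ‖w‖ ^ 2 * ⟪w, β⟫_ℝ) (stdGaussian V3) :=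
    i1.add (integrable_norm_sq_mul_inner_gaussian β)
  have i3 : Integrable (fun w : V3 => c * ‖w‖ ^ 4) (stdGaussian V3) := integrable_norm_pow_four_stdGaussian.const_mul c
  rw [h, integral_add i12 i3, integral_add i1 (integrable_norm_sq_mul_inner_gaussian β),
    integral_const_mul, integral_const_mul, integral_norm_sq_stdGaussian, integral_norm_sq_mul_inner_stdGaussian,
    integral_norm_pow_four_stdGaussian_three]
  simp
  ring

/-- **`E Q Q' = α'(α + 3c) + ⟪β, β'⟫ + c'(3α + 15c)`** for two quadratic observables. [folklore] -/
theorem integral_quad_mul_quad (α c α' c' : ℝ) (β β' : V3) :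
    ∫ w, (α + ⟪w, β⟫_ℝ + c * ‖w‖ ^ 2) * (α' + ⟪w, β'⟫_ℝ + c' * ‖w‖ ^ 2) ∂stdGaussian V3 =
      α' * (α + 3 * c) + ⟪β, β'⟫_ℝ + c' * (3 * α + 15 * c) := by
  have h : (fun w : V3 => (α + ⟪w, β⟫_ℝ + c * ‖w‖ ^ 2) * (α' + ⟪w, β'⟫_ℝ + c' * ‖w‖ ^ 2)) =
      fun w => α' * (α + ⟪w, β⟫_ℝ + c * ‖w‖ ^ 2) + (α + ⟪w, β⟫_ℝ + c * ‖w‖ ^ 2) * ⟪w, β'⟫_ℝ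
        + c' * ((α + ⟪w, β⟫_ℝ + c * ‖w‖ ^ 2) * ‖w‖ ^ 2) := funext fun w => by ring
  have i1 : Integrable (fun w : V3 => α' * (α + ⟪w, β⟫_ℝ + c * ‖w‖ ^ 2)) (stdGaussian V3) :=
    (integrable_quad α c β).const_mul α'
  have i12 : Integrable (fun w : V3 => α' * (α + ⟪w, β⟫_ℝ + c * ‖w‖ ^ 2) + (α + ⟪w, β⟫_ℝ + c * ‖w‖ ^ 2) * ⟪w, β'⟫_ℝ)
      (stdGaussian V3) := i1.add (integrable_quad_mul_inner α c β β')
  have i3 : Integrable (fun w : V3 => c' * ((α + ⟪w, β⟫_ℝ + c * ‖w‖ ^ 2) * ‖w‖ ^ 2)) (stdGaussian V3) :=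
    (integrable_quad_mul_norm_sq α c β).const_mul c'
  rw [h, integral_add i12 i3, integral_add i1 (integrable_quad_mul_inner α c β β'),
    integral_const_mul, integral_const_mul, integral_quad, integral_quad_mul_inner, integral_quad_mul_norm_sq]

/-! ### Marginals and independence under `γ^{⊗n}` -/

section Pi

variable {n : ℕ}

/-- **One velocity**: `∫ F(wᵢ) dγ^{⊗n} = ∫ F dγ`. [folklore] -/
theorem integral_comp_eval_gaussPi {F : V3 → ℝ} (hF : AEStronglyMeasurable F (stdGaussian V3)) (i : Fin n) :
    ∫ w, F (w i) ∂Measure.pi (fun _ : Fin n => stdGaussian V3) = ∫ y, F y ∂stdGaussian V3 := by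
  have hmp := measurePreserving_eval (fun _ : Fin n => stdGaussian V3) i
  have h := integral_map (μ := Measure.pi fun _ : Fin n => stdGaussian V3) (φ := Function.eval i)
    (measurable_pi_apply i).aemeasurable (f := F) (by rw [hmp.map_eq]; exact hF)
  rw [hmp.map_eq] at h
  exact h.symm

/-- One velocity: integrability. [folklore] -/
theorem integrable_comp_eval_gaussPi {F : V3 → ℝ} (hF : Integrable F (stdGaussian V3)) (i : Fin n) :
    Integrable (fun w : Fin n → V3 => F (w i)) (Measure.pi fun _ : Fin n => stdGaussian V3) :=
  ((measurePreserving_eval (fun _ : Fin n => stdGaussian V3) i).integrable_comp hF.aestronglyMeasurable).2 hF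

/-- The velocities are independent. [folklore] -/
theorem iIndepFun_eval_gaussPi :
    iIndepFun (fun i (w : Fin n → V3) => w i) (Measure.pi fun _ : Fin n => stdGaussian V3) :=
  iIndepFun_pi (X := fun _ => id) fun _ => aemeasurable_id

/-- **Two distinct velocities are independent**: `∫ F(wᵢ) G(wⱼ) dγ^{⊗n} = (∫ F dγ)(∫ G dγ)` for
`i ≠ j`. [folklore] -/
theorem integral_comp_eval_mul_comp_eval_gaussPi {F G : V3 → ℝ} (hF : Measurable F) (hG : Measurable G)
    {i j : Fin n} (hij : i ≠ j) :
    ∫ w, F (w i) * G (w j) ∂Measure.pi (fun _ : Fin n => stdGaussian V3) =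
      (∫ y, F y ∂stdGaussian V3) * ∫ y, G y ∂stdGaussian V3 := by
  have h2 : IndepFun (fun w : Fin n → V3 => F (w i)) (fun w : Fin n → V3 => G (w j))
      (Measure.pi fun _ : Fin n => stdGaussian V3) := (iIndepFun_eval_gaussPi.indepFun hij).comp hF hG
  rw [h2.integral_fun_mul_eq_mul_integral (hF.comp (measurable_pi_apply i)).aestronglyMeasurable
      (hG.comp (measurable_pi_apply j)).aestronglyMeasurable]
  beta_reduce
  rw [integral_comp_eval_gaussPi hF.aestronglyMeasurable, integral_comp_eval_gaussPi hG.aestronglyMeasurable]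

/-- Two distinct velocities: integrability of products. [folklore] -/
theorem integrable_comp_eval_mul_comp_eval_gaussPi {F G : V3 → ℝ} (hF : Measurable F) (hG : Measurable G)
    (hFi : Integrable F (stdGaussian V3)) (hGi : Integrable G (stdGaussian V3)) {i j : Fin n} (hij : i ≠ j) :
    Integrable (fun w : Fin n → V3 => F (w i) * G (w j)) (Measure.pi fun _ : Fin n => stdGaussian V3) := by
  have h2 : IndepFun (fun w : Fin n → V3 => F (w i)) (fun w : Fin n → V3 => G (w j))
      (Measure.pi fun _ : Fin n => stdGaussian V3) := (iIndepFun_eval_gaussPi.indepFun hij).comp hF hG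
  exact h2.integrable_mul (integrable_comp_eval_gaussPi hFi i) (integrable_comp_eval_gaussPi hGi j)

/-- **Two velocities, equal or not**: `∫ F(wᵢ) G(wⱼ) dγ^{⊗n}` is `∫ F G dγ` if `i = j` and
`(∫ F dγ)(∫ G dγ)` otherwise. [folklore] -/
theorem integral_comp_eval_mul_comp_eval_gaussPi' {F G : V3 → ℝ} (hF : Measurable F) (hG : Measurable G)
    (i j : Fin n) :
    ∫ w, F (w i) * G (w j) ∂Measure.pi (fun _ : Fin n => stdGaussian V3) =
      if i = j then ∫ y, F y * G y ∂stdGaussian V3 else (∫ y, F y ∂stdGaussian V3) * ∫ y, G y ∂stdGaussian V3 := by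
  split_ifs with hij
  · subst hij
    exact integral_comp_eval_gaussPi (hF.mul hG).aestronglyMeasurable i
  · exact integral_comp_eval_mul_comp_eval_gaussPi hF hG hij

/-- Two velocities, equal or not: integrability. [folklore] -/
theorem integrable_comp_eval_mul_comp_eval_gaussPi' {F G : V3 → ℝ} (hF : Measurable F) (hG : Measurable G)
    (hFi : Integrable F (stdGaussian V3)) (hGi : Integrable G (stdGaussian V3))
    (hFG : Integrable (fun y => F y * G y) (stdGaussian V3)) (i j : Fin n) :
    Integrable (fun w : Fin n → V3 => F (w i) * G (w j)) (Measure.pi fun _ : Fin n => stdGaussian V3) := by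
  by_cases hij : i = j
  · subst hij
    exact integrable_comp_eval_gaussPi hFG i
  · exact integrable_comp_eval_mul_comp_eval_gaussPi hF hG hFi hGi hij

/-- The weight `(1 + ‖wᵢ‖²)(1 + ‖wⱼ‖²)` is `γ^{⊗n}`-integrable. [folklore] -/
theorem integrable_weight_gaussPi (i j : Fin n) :
    Integrable (fun w : Fin n → V3 => (1 + ‖w i‖ ^ 2) * (1 + ‖w j‖ ^ 2)) (Measure.pi fun _ : Fin n => stdGaussian V3) := by
  have hm : Measurable fun y : V3 => 1 + ‖y‖ ^ 2 := by fun_prop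
  have hi : Integrable (fun y : V3 => 1 + ‖y‖ ^ 2) (stdGaussian V3) := (integrable_const 1).add integrable_norm_sq_gaussian
  refine integrable_comp_eval_mul_comp_eval_gaussPi' hm hm hi hi ?_ i j
  have h : (fun y : V3 => (1 + ‖y‖ ^ 2) * (1 + ‖y‖ ^ 2)) = fun y => 1 + 2 * ‖y‖ ^ 2 + ‖y‖ ^ 4 := funext fun y => by ring
  rw [h]
  exact ((integrable_const 1).add (integrable_norm_sq_gaussian.const_mul 2)).add integrable_norm_pow_four_stdGaussian

/-- **Integrability under `γ^{⊗n}` from a two-velocity quadratic bound.** [folklore] -/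
theorem integrable_gaussPi_of_le {Φ : (Fin n → V3) → ℝ}
    (hΦ : AEStronglyMeasurable Φ (Measure.pi fun _ : Fin n => stdGaussian V3)) (i j : Fin n) {C : ℝ}
    (h : ∀ w, |Φ w| ≤ C * ((1 + ‖w i‖ ^ 2) * (1 + ‖w j‖ ^ 2))) :
    Integrable Φ (Measure.pi fun _ : Fin n => stdGaussian V3) :=
  Integrable.mono' ((integrable_weight_gaussPi i j).const_mul C) hΦ
    (ae_of_all _ fun w => by rw [Real.norm_eq_abs]; exact h w)

/-- **Integrability under `ν ⊗ γ^{⊗n}`, `ν` finite, from a two-velocity quadratic bound.**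
[folklore] -/
theorem integrable_prod_gaussPi_of_le {X : Type*} [MeasurableSpace X] (ν : Measure X) [IsFiniteMeasure ν]
    {Φ : X × (Fin n → V3) → ℝ} (hΦ : AEStronglyMeasurable Φ (ν.prod (Measure.pi fun _ : Fin n => stdGaussian V3)))
    (i j : Fin n) {C : ℝ} (h : ∀ p, |Φ p| ≤ C * ((1 + ‖p.2 i‖ ^ 2) * (1 + ‖p.2 j‖ ^ 2))) :
    Integrable Φ (ν.prod (Measure.pi fun _ : Fin n => stdGaussian V3)) :=
  Integrable.mono' (((integrable_weight_gaussPi i j).comp_snd ν).const_mul C) hΦ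
    (ae_of_all _ fun p => by rw [Real.norm_eq_abs]; exact h p)

/-- **Sums of one-velocity observables**: `∫ ∑ᵢ Fᵢ(wᵢ) dγ^{⊗n} = ∑ᵢ ∫ Fᵢ dγ`. [folklore] -/
theorem integral_sum_comp_eval_gaussPi {F : Fin n → V3 → ℝ} (hF : ∀ i, Integrable (F i) (stdGaussian V3)) :
    ∫ w, ∑ i, F i (w i) ∂Measure.pi (fun _ : Fin n => stdGaussian V3) = ∑ i, ∫ y, F i y ∂stdGaussian V3 := by
  rw [integral_finsetSum _ fun i _ => integrable_comp_eval_gaussPi (hF i) i]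
  exact Finset.sum_congr rfl fun i _ => integral_comp_eval_gaussPi (hF i).aestronglyMeasurable i

/-- **Second-moment bookkeeping.** For one-velocity observables `Hᵢ` of mean zero and `Pⱼ`:
`∫ (∑ᵢ (cᵢ + Hᵢ(wᵢ))) (∑ⱼ dⱼ Pⱼ(wⱼ)) dγ^{⊗n} = (∑ᵢ cᵢ)(∑ⱼ dⱼ E Pⱼ) + ∑ᵢ dᵢ E (Hᵢ Pᵢ)` — the cross
terms `i ≠ j` vanish by independence. [folklore] -/
theorem integral_sum_mul_sum_gaussPi {H P : Fin n → V3 → ℝ} (c d : Fin n → ℝ)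
    (hHm : ∀ i, Measurable (H i)) (hPm : ∀ i, Measurable (P i))
    (hH : ∀ i, Integrable (H i) (stdGaussian V3)) (hP : ∀ i, Integrable (P i) (stdGaussian V3))
    (hHP : ∀ i, Integrable (fun y => H i y * P i y) (stdGaussian V3)) (hH0 : ∀ i, ∫ y, H i y ∂stdGaussian V3 = 0) :
    ∫ w, (∑ i, (c i + H i (w i))) * (∑ j, d j * P j (w j)) ∂Measure.pi (fun _ : Fin n => stdGaussian V3) =
      (∑ i, c i) * (∑ j, d j * ∫ y, P j y ∂stdGaussian V3) + ∑ i, d i * ∫ y, H i y * P i y ∂stdGaussian V3 := by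
  set Γ := Measure.pi (fun _ : Fin n => stdGaussian V3) with hΓ
  -- termwise integrability and integrals
  have hHPij : ∀ i j, Integrable (fun w : Fin n → V3 => H i (w i) * P j (w j)) Γ := by
    intro i j
    by_cases hij : i = j
    · subst hij
      exact integrable_comp_eval_gaussPi (hHP i) i
    · exact integrable_comp_eval_mul_comp_eval_gaussPi (hHm i) (hPm j) (hH i) (hP j) hij
  have h1 : ∀ i j, Integrable (fun w : Fin n → V3 => c i * d j * P j (w j)) Γ := fun i j =>
    (integrable_comp_eval_gaussPi (hP j) j).const_mul _
  have h2 : ∀ i j, Integrable (fun w : Fin n → V3 => d j * (H i (w i) * P j (w j))) Γ := fun i j =>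
    (hHPij i j).const_mul _
  have hexp : ∀ i j, (fun w : Fin n → V3 => (c i + H i (w i)) * (d j * P j (w j))) =
      fun w => c i * d j * P j (w j) + d j * (H i (w i) * P j (w j)) := fun i j => funext fun w => by ring
  have hterm : ∀ i j, Integrable (fun w : Fin n → V3 => (c i + H i (w i)) * (d j * P j (w j))) Γ := by
    intro i j
    rw [hexp i j]
    exact (h1 i j).add (h2 i j)
  have hval : ∀ i j, ∫ w, (c i + H i (w i)) * (d j * P j (w j)) ∂Γ =
      c i * d j * ∫ y, P j y ∂stdGaussian V3 + (if i = j then d i * ∫ y, H i y * P i y ∂stdGaussian V3 else 0) := by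
    intro i j
    rw [hexp i j, integral_add (h1 i j) (h2 i j), integral_const_mul, integral_const_mul,
      integral_comp_eval_gaussPi (hP j).aestronglyMeasurable, integral_comp_eval_mul_comp_eval_gaussPi' (hHm i) (hPm j)]
    split_ifs with hij
    · subst hij; rfl
    · rw [hH0 i]; ring
  -- expand the product of sums and integrate termwise
  simp_rw [Finset.sum_mul_sum]
  rw [integral_finsetSum _ fun i _ => integrable_finsetSum _ fun j _ => hterm i j]
  rw [Finset.sum_congr rfl fun i _ => integral_finsetSum _ fun j _ => hterm i j]
  simp_rw [hval, Finset.sum_add_distrib, Finset.sum_ite_eq, Finset.mem_univ, if_true]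
  congr 1
  exact Finset.sum_congr rfl fun i _ => Finset.sum_congr rfl fun j _ => by ring

end Pi

end Summit.AtomisticToContinuum.HydrodynamicLimit.Theorems

end
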